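import Literature.MathematicalPhysics.QuantumManyBody.DiluteBoseGasTrialState
import Literature.MathematicalPhysics.QuantumManyBody.TorusGalerkinBounds
import Literature.MathematicalPhysics.QuantumManyBody.DiluteBoseGasPotentialFourier
import HarnessLib

/-!
# The BCS trial state: pointwise properties of the amplitudes `t_p, σ_p, γ_p, η_p, ĝ₀`

Topic `Literature/MathematicalPhysics/QuantumManyBody`, namespace `BoseGas.BCSTrial`; theorem-only, for
the provefact `Literature.MathematicalPhysics.QuantumManyBody.BoseGas.BastiCenatiempoSchlein2021_upperBound`.
The pointwise inputs of §5 of [BastiCenatiempoSchlein2021] for the concrete trial state of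
`DiluteBoseGasTrialState.lean`:

* evenness and the value at the condensate of `c, η, t`; `pairCoeff = tAmp`; `|t_p| < 1`;
* `0 ≤ ĝ₀ ≤ W(0) = ∫v`, `|W(k)| ≤ W(0)`;
* `σ_p², γ_pσ_p, γ_p²` through `t_p`; on `P_L` the closed forms `(ε+g-R)/(2R)`, `-g/(2R)` and the
  bounds `σ_p² ≤ g/(2R)`, `(g/(2R))² ≤ g/(8ε_p)`, `σ_p² ≤ g²/(2ε_p²)`; off `P_L` the bounds
  `σ_p² ≤ (4/3)η_p²`, `|γ_pσ_p| ≤ (4/3)|η_p|`, `γ_p² ≤ 4/3`;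
* **`|η_p| ≤ ρW(0)L²/(8π²|n|²)`** (the bound (2.4) `|η_p| ≤ CN^κ/p²`, from `abs_coeff_le_of_min`).

## References

* [BastiCenatiempoSchlein2021] G. Basti, S. Cenatiempo, B. Schlein, Forum Math. Sigma 9 (2021) e74,
  arXiv:2101.06222: (2.4), (2.9)–(2.11), Lemma 2.2, §5.
-/

noncomputable section

namespace Literature.MathematicalPhysics.QuantumManyBody.BoseGas

open MeasureTheory Complex Finset
open scoped ENNReal BigOperators

namespace BCSTrial

variable {v : ℝ → ℝ≥0∞} {ρ : ℝ}

/-! ### Sums over the box: condensate plus band -/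

/-- `∑_{p ∈ box} f(p) = f(z) + ∑_{p ∈ band} f(p)`. [folklore] -/
theorem sum_modeBox_eq_add_sum_band (f : ModeBox (boxSize ρ) → ℝ) :
    ∑ p, f p = f (z _) + ∑ p : Band ρ, f p.1 := by
  classical
  rw [← Finset.sum_erase_add _ _ (Finset.mem_univ (z (boxSize ρ))), add_comm]
  congr 1
  refine Finset.sum_subtype _ (fun p => ?_) f
  simp

/-! ### Evenness and the condensate mode -/

/-- `c_z = 0`. [folklore] -/
theorem cExt_z (v : ℝ → ℝ≥0∞) (ρ : ℝ) : cExt v ρ (z _) = 0 := by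
  simp [cExt]

/-- `η_z = 0`. [folklore] -/
theorem eta_z (v : ℝ → ℝ≥0∞) (ρ : ℝ) : eta v ρ (z _) = 0 := by
  simp [eta, cExt_z]

/-- `c` is even. [folklore] -/
theorem cExt_neg (hv : Measurable v) (hint : (∫⁻ x : Space, v ‖x‖) ≠ ⊤) (hρ : 0 < ρ) (p : ModeBox (boxSize ρ)) :
    cExt v ρ (neg _ p) = cExt v ρ p := by
  by_cases hp : p = z _
  · subst hp; rw [neg_z]
  · have hnp : neg _ p ≠ z _ := fun h => hp (by rw [← neg_neg _ p, h, neg_z])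
    unfold cExt
    rw [dif_neg hnp, dif_neg hp]
    have h := (galerkinMin_spec hv hint hρ).2.1 ⟨p, hp⟩
    exact h

/-- `η` is even. [folklore] -/
theorem eta_neg (hv : Measurable v) (hint : (∫⁻ x : Space, v ‖x‖) ≠ ⊤) (hρ : 0 < ρ) (p : ModeBox (boxSize ρ)) :
    eta v ρ (neg _ p) = eta v ρ p := by
  simp [eta, cExt_neg hv hint hρ]

/-- `t` is even. [folklore] -/
theorem tAmp_neg (hv : Measurable v) (hint : (∫⁻ x : Space, v ‖x‖) ≠ ⊤) (hρ : 0 < ρ) (p : ModeBox (boxSize ρ)) :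
    tAmp v ρ (neg _ p) = tAmp v ρ p := by
  unfold tAmp
  rw [eps_neg, eta_neg hv hint hρ]
  simp only [neg_mem_lowSet_iff]

/-- `t_z = 0`. [folklore] -/
theorem tAmp_z (v : ℝ → ℝ≥0∞) (ρ : ℝ) : tAmp v ρ (z _) = 0 := by
  unfold tAmp
  rw [if_neg z_not_mem_lowSet, eta_z]
  simp [clip]

/-- **The extended pair amplitude is `t` itself** (`t` is even and vanishes at the condensate).
[folklore] -/
theorem pairCoeff_eq_tAmp (hv : Measurable v) (hint : (∫⁻ x : Space, v ‖x‖) ≠ ⊤) (hρ : 0 < ρ) (p : ModeBox (boxSize ρ)) :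
    Fock.pairCoeff (neg _) (halfSpace _) (tAmp v ρ) p = tAmp v ρ p := by
  by_cases hp : p ∈ halfSpace _
  · exact Fock.pairCoeff_of_mem hp
  · by_cases hpz : p = z _
    · subst hpz
      rw [Fock.pairCoeff_of_inert z_not_mem_halfSpace (by rw [neg_z]; exact z_not_mem_halfSpace), tAmp_z]
    · have hnp : neg _ p ∈ halfSpace _ := (mem_halfSpace_or hpz).resolve_left hp
      rw [Fock.pairCoeff_of_partner_mem hp hnp, tAmp_neg hv hint hρ]

/-! ### `ĝ₀` and `W` -/

/-- `W(0) = ∫v`. [folklore] -/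
theorem W_zero (v : ℝ → ℝ≥0∞) (ρ : ℝ) : W v ρ 0 = ∫ x : Space, (v ‖x‖).toReal := by
  unfold W; rw [potFT_zero, Complex.ofReal_re]

/-- `0 ≤ W(0)`. [folklore] -/
theorem W_zero_nonneg (v : ℝ → ℝ≥0∞) (ρ : ℝ) : 0 ≤ W v ρ 0 := by
  rw [W_zero]; exact integral_nonneg fun x => ENNReal.toReal_nonneg

/-- **`|W(k)| ≤ W(0)`.** [folklore] -/
theorem abs_W_le (v : ℝ → ℝ≥0∞) (ρ : ℝ) (k : Momentum) : |W v ρ k| ≤ W v ρ 0 := by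
  unfold W
  rw [potFT_zero, Complex.ofReal_re]
  exact (Complex.abs_re_le_norm _).trans (norm_potFT_le v _ k)

/-- **`ĝ₀ = 2L³E(c)`** (the energy of the Galerkin minimiser). [cite: BastiCenatiempoSchlein2021, Lemma 2.1 (ii)] -/
theorem gHat0_eq (hv : Measurable v) (hint : (∫⁻ x : Space, v ‖x‖) ≠ ⊤) (hρ : 0 < ρ) :
    gHat0 v ρ = 2 * boxSide ρ ^ 3 *
      galerkinEnergy (fun p : Band ρ => e _ p.1) (fun p => eps ρ p.1) (W v ρ) (boxSide ρ) (galerkinMin v ρ) := by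
  have hL := boxSide_pos hρ
  rw [galerkinEnergy_eq_of_euler_lagrange hL (galerkinMin_spec hv hint hρ).2.2]
  unfold gHat0
  rw [sum_modeBox_eq_add_sum_band, cExt_z, mul_zero, zero_add]
  have hc : ∀ p : Band ρ, cExt v ρ p.1 = galerkinMin v ρ p := fun p => by
    unfold cExt; rw [dif_neg p.2]
  simp only [hc]
  field_simp

/-- **`0 ≤ ĝ₀`** (`E ≥ 0`). [folklore] -/
theorem gHat0_nonneg (hv : Measurable v) (hint : (∫⁻ x : Space, v ‖x‖) ≠ ⊤) (hρ : 0 < ρ) : 0 ≤ gHat0 v ρ := by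
  rw [gHat0_eq hv hint hρ]
  have hL := boxSide_pos hρ
  refine mul_nonneg (by positivity) (add_nonneg (Finset.sum_nonneg fun p _ => mul_nonneg (eps_nonneg _) (sq_nonneg _)) ?_)
  exact mul_nonneg (by positivity) (galerkinPot_re_potFT_nonneg hv hint _ _ _)

/-- **`ĝ₀ ≤ W(0)`** (`E(c) ≤ E(0)`). [folklore] -/
theorem gHat0_le (hv : Measurable v) (hint : (∫⁻ x : Space, v ‖x‖) ≠ ⊤) (hρ : 0 < ρ) : gHat0 v ρ ≤ W v ρ 0 := by
  rw [gHat0_eq hv hint hρ]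
  have hL := boxSide_pos hρ
  have hmin := (galerkinMin_spec hv hint hρ).1 (fun _ => 0)
  have hE0 : galerkinEnergy (fun p : Band ρ => e _ p.1) (fun p => eps ρ p.1) (W v ρ) (boxSide ρ) (fun _ => 0) =
      (2 * boxSide ρ ^ 3)⁻¹ * W v ρ 0 := by
    simp [galerkinEnergy, galerkinPot]
  rw [hE0] at hmin
  calc 2 * boxSide ρ ^ 3 * galerkinEnergy (fun p : Band ρ => e _ p.1) (fun p => eps ρ p.1) (W v ρ) (boxSide ρ) (galerkinMin v ρ)
      ≤ 2 * boxSide ρ ^ 3 * ((2 * boxSide ρ ^ 3)⁻¹ * W v ρ 0) := mul_le_mul_of_nonneg_left hmin (by positivity)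
    _ = W v ρ 0 := by field_simp

/-- `0 ≤ g = ρĝ₀`. [folklore] -/
theorem gCoupling_nonneg (hv : Measurable v) (hint : (∫⁻ x : Space, v ‖x‖) ≠ ⊤) (hρ : 0 < ρ) : 0 ≤ gCoupling v ρ :=
  mul_nonneg hρ.le (gHat0_nonneg hv hint hρ)

/-- `g ≤ ρW(0)`. [folklore] -/
theorem gCoupling_le (hv : Measurable v) (hint : (∫⁻ x : Space, v ‖x‖) ≠ ⊤) (hρ : 0 < ρ) : gCoupling v ρ ≤ ρ * W v ρ 0 :=
  mul_le_mul_of_nonneg_left (gHat0_le hv hint hρ) hρ.le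

/-! ### `|t| < 1` -/

/-- `|clip x| ≤ |x|`. [folklore] -/
theorem abs_clip_le_abs (x : ℝ) : |clip x| ≤ |x| := by
  unfold clip
  rcases le_total x (1 / 2) with h | h
  · rw [min_eq_right h]
    rcases le_total (-(1 / 2 : ℝ)) x with h' | h'
    · rw [max_eq_right h']
    · rw [max_eq_left h', abs_of_neg (by norm_num : (-(1 / 2 : ℝ)) < 0)]
      rw [abs_of_nonpos (by linarith)]; linarith
  · rw [min_eq_left h, max_eq_right (by norm_num), abs_of_pos (by norm_num : (0 : ℝ) < 1 / 2), abs_of_pos (by linarith)]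
    exact h

/-- Off `P_L`, `|t_p| ≤ 1/2`. [folklore] -/
theorem abs_tAmp_le_half {p : ModeBox (boxSize ρ)} (hp : p ∉ lowSet ρ) : |tAmp v ρ p| ≤ 1 / 2 := by
  unfold tAmp; rw [if_neg hp]; exact abs_clip_le _

/-- Off `P_L`, `|t_p| ≤ |η_p|`. [folklore] -/
theorem abs_tAmp_le_abs_eta {p : ModeBox (boxSize ρ)} (hp : p ∉ lowSet ρ) : |tAmp v ρ p| ≤ |eta v ρ p| := by
  unfold tAmp; rw [if_neg hp]; exact abs_clip_le_abs _

/-- On `P_L`, `t_p = bogTanh g ε_p`. [folklore] -/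
theorem tAmp_of_mem {p : ModeBox (boxSize ρ)} (hp : p ∈ lowSet ρ) : tAmp v ρ p = bogTanh (gCoupling v ρ) (eps ρ p) := by
  unfold tAmp; rw [if_pos hp]

/-- A mode of `P_L` is not the condensate. [folklore] -/
theorem ne_z_of_mem_lowSet {p : ModeBox (boxSize ρ)} (hp : p ∈ lowSet ρ) : p ≠ z _ := fun h => z_not_mem_lowSet (h ▸ hp)

/-- `ε_p > 0` off the condensate. [folklore] -/
theorem eps_pos' (hρ : 0 < ρ) {p : ModeBox (boxSize ρ)} (hp : p ≠ z _) : 0 < eps ρ p :=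
  lt_of_lt_of_le (by have := boxSide_pos hρ; positivity) (eps_pos hρ hp)

/-- **`|t_p| < 1` on every mode.** [folklore] -/
theorem abs_tAmp_lt_one (hv : Measurable v) (hint : (∫⁻ x : Space, v ‖x‖) ≠ ⊤) (hρ : 0 < ρ) (p : ModeBox (boxSize ρ)) :
    |tAmp v ρ p| < 1 := by
  by_cases hp : p ∈ lowSet ρ
  · rw [tAmp_of_mem hp]
    exact abs_bogTanh_lt_one (eps_pos' hρ (ne_z_of_mem_lowSet hp)) (gCoupling_nonneg hv hint hρ)
  · exact (abs_tAmp_le_half hp).trans_lt (by norm_num)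

/-- The hypothesis `∀ p ∈ P, |t p| < 1` of the Bogoliubov–Weyl calculus. [folklore] -/
theorem abs_tAmp_lt_one' (hv : Measurable v) (hint : (∫⁻ x : Space, v ‖x‖) ≠ ⊤) (hρ : 0 < ρ) :
    ∀ p ∈ halfSpace (boxSize ρ), |tAmp v ρ p| < 1 := fun p _ => abs_tAmp_lt_one hv hint hρ p

/-! ### `σ², γσ, γ²` through `t` -/

section Angles

variable (hv : Measurable v) (hint : (∫⁻ x : Space, v ‖x‖) ≠ ⊤) (hρ : 0 < ρ)
include hv hint hρ

/-- `1 - t_p² > 0`. [folklore] -/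
theorem one_sub_tAmp_sq_pos (p : ModeBox (boxSize ρ)) : 0 < 1 - tAmp v ρ p ^ 2 := by
  have h := abs_tAmp_lt_one hv hint hρ p
  have h0 := abs_nonneg (tAmp v ρ p)
  rw [← sq_abs]; nlinarith

/-- **`γ_p² = 1/(1 - t_p²)`.** [folklore] -/
theorem bogGamma_sq_eq (p : ModeBox (boxSize ρ)) :
    Fock.bogGamma (neg _) (halfSpace _) (tAmp v ρ) p ^ 2 = (1 - tAmp v ρ p ^ 2)⁻¹ := by
  have h := Fock.bogGamma_sq_mul (σ := neg _) (P := halfSpace _) (t := tAmp v ρ) (abs_tAmp_lt_one' hv hint hρ) p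
  rw [pairCoeff_eq_tAmp hv hint hρ] at h
  have hpos := one_sub_tAmp_sq_pos hv hint hρ p
  field_simp
  linarith [h]

/-- **`σ_p² = t_p²/(1 - t_p²)`.** [folklore] -/
theorem bogSigma_sq_eq (p : ModeBox (boxSize ρ)) :
    Fock.bogSigma (neg _) (halfSpace _) (tAmp v ρ) p ^ 2 = tAmp v ρ p ^ 2 / (1 - tAmp v ρ p ^ 2) := by
  unfold Fock.bogSigma
  rw [mul_pow, bogGamma_sq_eq hv hint hρ, pairCoeff_eq_tAmp hv hint hρ, div_eq_mul_inv]

/-- **`γ_pσ_p = t_p/(1 - t_p²)`.** [folklore] -/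
theorem bogGamma_mul_bogSigma_eq (p : ModeBox (boxSize ρ)) :
    Fock.bogGamma (neg _) (halfSpace _) (tAmp v ρ) p * Fock.bogSigma (neg _) (halfSpace _) (tAmp v ρ) p =
      tAmp v ρ p / (1 - tAmp v ρ p ^ 2) := by
  unfold Fock.bogSigma
  rw [pairCoeff_eq_tAmp hv hint hρ, show Fock.bogGamma (neg _) (halfSpace _) (tAmp v ρ) p *
    (tAmp v ρ p * Fock.bogGamma (neg _) (halfSpace _) (tAmp v ρ) p) =
    tAmp v ρ p * Fock.bogGamma (neg _) (halfSpace _) (tAmp v ρ) p ^ 2 by ring, bogGamma_sq_eq hv hint hρ, div_eq_mul_inv]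

/-- On `P_L`: **`σ_p² = (ε_p + g - R_p)/(2R_p)`**, `R_p = √(ε_p² + 2gε_p)`. [cite: BastiCenatiempoSchlein2021, (2.11)] -/
theorem bogSigma_sq_of_mem {p : ModeBox (boxSize ρ)} (hp : p ∈ lowSet ρ) :
    Fock.bogSigma (neg _) (halfSpace _) (tAmp v ρ) p ^ 2 =
      (eps ρ p + gCoupling v ρ - Real.sqrt (eps ρ p ^ 2 + 2 * gCoupling v ρ * eps ρ p)) /
        (2 * Real.sqrt (eps ρ p ^ 2 + 2 * gCoupling v ρ * eps ρ p)) := by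
  rw [bogSigma_sq_eq hv hint hρ, tAmp_of_mem hp]
  exact bogTanh_sq_div (eps_pos' hρ (ne_z_of_mem_lowSet hp)) (gCoupling_nonneg hv hint hρ)

/-- On `P_L`: **`γ_pσ_p = -g/(2R_p)`.** [cite: BastiCenatiempoSchlein2021, (2.11)] -/
theorem bogGamma_mul_bogSigma_of_mem {p : ModeBox (boxSize ρ)} (hp : p ∈ lowSet ρ) :
    Fock.bogGamma (neg _) (halfSpace _) (tAmp v ρ) p * Fock.bogSigma (neg _) (halfSpace _) (tAmp v ρ) p =
      -gCoupling v ρ / (2 * Real.sqrt (eps ρ p ^ 2 + 2 * gCoupling v ρ * eps ρ p)) := by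
  rw [bogGamma_mul_bogSigma_eq hv hint hρ, tAmp_of_mem hp]
  exact bogTanh_div (eps_pos' hρ (ne_z_of_mem_lowSet hp)) (gCoupling_nonneg hv hint hρ)

/-- On `P_L`: **`σ_p² ≤ g/(2R_p)`, `(g/(2R_p))² ≤ g/(8ε_p)`, `g/(2R_p) ≤ g/(2ε_p)`** — hence
`σ_p² ≤ ½√(g/(2ε_p))` (the bound `‖σ_L‖∞² ≤ CN^{κ/2}/|p|` of [ibid., after (2.11)]) and
`|γ_pσ_p| = g/(2R_p)` obeys the same. [cite: BastiCenatiempoSchlein2021, §2 (bounds after (2.11))] -/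
theorem bogSigma_sq_le_of_mem {p : ModeBox (boxSize ρ)} (hp : p ∈ lowSet ρ) :
    Fock.bogSigma (neg _) (halfSpace _) (tAmp v ρ) p ^ 2 ≤
        gCoupling v ρ / (2 * Real.sqrt (eps ρ p ^ 2 + 2 * gCoupling v ρ * eps ρ p)) ∧
      (gCoupling v ρ / (2 * Real.sqrt (eps ρ p ^ 2 + 2 * gCoupling v ρ * eps ρ p))) ^ 2 ≤ gCoupling v ρ / (8 * eps ρ p) ∧
      gCoupling v ρ / (2 * Real.sqrt (eps ρ p ^ 2 + 2 * gCoupling v ρ * eps ρ p)) ≤ gCoupling v ρ / (2 * eps ρ p) := by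
  have hε := eps_pos' hρ (ne_z_of_mem_lowSet hp)
  have hg := gCoupling_nonneg hv hint hρ
  have hb := coshSinh_bounds hε hg
  refine ⟨?_, hb.2, hb.1⟩
  rw [bogSigma_sq_of_mem hv hint hρ hp]
  have hR := sqrt_dispersion_pos hε hg
  obtain ⟨hRge, -⟩ := sqrt_dispersion_bounds hε hg
  rw [div_le_div_iff_of_pos_right (by positivity)]
  linarith

/-- On `P_L`: **`σ_p² ≤ g²/(2ε_p²)`** (the regime `|p| ≫ N^{κ/2}`). [cite: BastiCenatiempoSchlein2021, §2] -/
theorem bogSigma_sq_le_of_mem' {p : ModeBox (boxSize ρ)} (hp : p ∈ lowSet ρ) :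
    Fock.bogSigma (neg _) (halfSpace _) (tAmp v ρ) p ^ 2 ≤ gCoupling v ρ ^ 2 / (2 * eps ρ p ^ 2) := by
  have hε := eps_pos' hρ (ne_z_of_mem_lowSet hp)
  have hg := gCoupling_nonneg hv hint hρ
  rw [bogSigma_sq_of_mem hv hint hρ hp]
  refine (sinhSq_le hε hg).trans ?_
  exact div_le_div_of_nonneg_left (sq_nonneg _) (by positivity) (by nlinarith [mul_nonneg hg hε.le])

/-- Off `P_L`: **`σ_p² ≤ (4/3)η_p²`, `|γ_pσ_p| ≤ (4/3)|η_p|`, `γ_p² ≤ 4/3`** (`|t_p| ≤ min(1/2, |η_p|)`).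
[cite: BastiCenatiempoSchlein2021, §2 ("`‖γ_H‖∞ ≤ C`, `|σ_H(p)| ≤ C|η_p|`")] -/
theorem angles_le_of_not_mem {p : ModeBox (boxSize ρ)} (hp : p ∉ lowSet ρ) :
    Fock.bogSigma (neg _) (halfSpace _) (tAmp v ρ) p ^ 2 ≤ 4 / 3 * eta v ρ p ^ 2 ∧
      |Fock.bogGamma (neg _) (halfSpace _) (tAmp v ρ) p * Fock.bogSigma (neg _) (halfSpace _) (tAmp v ρ) p| ≤
        4 / 3 * |eta v ρ p| ∧
      Fock.bogGamma (neg _) (halfSpace _) (tAmp v ρ) p ^ 2 ≤ 4 / 3 := by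
  have ht := abs_tAmp_le_half (v := v) hp
  have hte := abs_tAmp_le_abs_eta (v := v) hp
  have h1 : 3 / 4 ≤ 1 - tAmp v ρ p ^ 2 := by
    rw [← sq_abs]; nlinarith [abs_nonneg (tAmp v ρ p)]
  have hpos : 0 < 1 - tAmp v ρ p ^ 2 := by linarith
  have hinv : (1 - tAmp v ρ p ^ 2)⁻¹ ≤ 4 / 3 := by
    rw [inv_le_comm₀ hpos (by norm_num)]; linarith
  refine ⟨?_, ?_, ?_⟩
  · rw [bogSigma_sq_eq hv hint hρ, div_eq_mul_inv]
    have h2 : tAmp v ρ p ^ 2 ≤ eta v ρ p ^ 2 := by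
      rw [← sq_abs, ← sq_abs (eta v ρ p)]; exact pow_le_pow_left₀ (abs_nonneg _) hte 2
    calc tAmp v ρ p ^ 2 * (1 - tAmp v ρ p ^ 2)⁻¹ ≤ eta v ρ p ^ 2 * (4 / 3) :=
          mul_le_mul h2 hinv (inv_nonneg.2 hpos.le) (sq_nonneg _)
      _ = 4 / 3 * eta v ρ p ^ 2 := by ring
  · rw [bogGamma_mul_bogSigma_eq hv hint hρ, abs_div, abs_of_pos hpos, div_eq_mul_inv]
    calc |tAmp v ρ p| * (1 - tAmp v ρ p ^ 2)⁻¹ ≤ |eta v ρ p| * (4 / 3) :=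
          mul_le_mul hte hinv (inv_nonneg.2 hpos.le) (abs_nonneg _)
      _ = 4 / 3 * |eta v ρ p| := by ring
  · rw [bogGamma_sq_eq hv hint hρ]; exact hinv

end Angles

/-! ### The pointwise bound on `η` -/

/-- Bochner positivity on the band with the zero slot adjoined. [folklore] -/
theorem band_option_pos (hv : Measurable v) (hint : (∫⁻ x : Space, v ‖x‖) ≠ ⊤) (ρ : ℝ) :
    ∀ u : Option (Band ρ) → ℝ, 0 ≤ ∑ a, ∑ b,
      W v ρ ((a.elim 0 fun p : Band ρ => e _ p.1) - (b.elim 0 fun p : Band ρ => e _ p.1)) * u a * u b :=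
  fun u => sum_sum_re_potFT_mul_mul_nonneg hv hint (boxSide ρ) (fun a : Option (Band ρ) => a.elim 0 fun p : Band ρ => e _ p.1) u

/-- **`2L³ε_p|c_p| ≤ W(0)`** on the band. [cite: BastiCenatiempoSchlein2021, (2.4)] -/
theorem abs_coeff_le (hv : Measurable v) (hint : (∫⁻ x : Space, v ‖x‖) ≠ ⊤) (hρ : 0 < ρ) (p : Band ρ) :
    |2 * boxSide ρ ^ 3 * eps ρ p.1 * galerkinMin v ρ p| ≤ W v ρ 0 := by
  have hspec := galerkinMin_spec hv hint hρ
  exact abs_coeff_le_of_min (e := fun p : Band ρ => e _ p.1) (boxSide_pos hρ) (fun q => eps_nonneg q.1) (W_neg v ρ)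
    (W_zero_nonneg v ρ) (band_option_pos hv hint ρ) hspec.1 hspec.2.2 p

/-- **`|η_p| ≤ ρW(0)L²/(8π²|n|²)`** for every nonzero mode (`η = -Nc`, `N = ρL³`,
`ε_p = 4π²|n|²/L²`) — the bound `|η_p| ≤ CN^κ/p²` of (2.4) with the explicit constant.
[cite: BastiCenatiempoSchlein2021, (2.4)] -/
theorem abs_eta_le (hv : Measurable v) (hint : (∫⁻ x : Space, v ‖x‖) ≠ ⊤) (hρ : 0 < ρ) {p : ModeBox (boxSize ρ)} (hp : p ≠ z _) :
    |eta v ρ p| ≤ ρ * W v ρ 0 * boxSide ρ ^ 2 / (8 * Real.pi ^ 2 * nsq (e _ p)) := by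
  have hL := boxSide_pos hρ
  have h := abs_coeff_le hv hint hρ ⟨p, hp⟩
  have hε : 0 < eps ρ p := eps_pos' hρ hp
  have hn : 0 < nsq (e _ p) := by
    have := one_le_nsq (n := e _ p) (fun h0 => hp ((e_eq_zero_iff _ p).1 h0)); linarith
  have hc : cExt v ρ p = galerkinMin v ρ ⟨p, hp⟩ := by unfold cExt; rw [dif_neg hp]
  unfold eta particleNumber
  rw [hc, abs_mul, abs_neg, abs_of_pos (by positivity : 0 < ρ * boxSide ρ ^ 3)]
  rw [abs_mul, abs_of_pos (by positivity : 0 < 2 * boxSide ρ ^ 3 * eps ρ p)] at h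
  rw [eps_eq] at h hε
  rw [le_div_iff₀ (by positivity)]
  have h' : boxSide ρ ^ 3 * (8 * Real.pi ^ 2 * nsq (e _ p)) * |galerkinMin v ρ ⟨p, hp⟩| ≤ W v ρ 0 * boxSide ρ ^ 2 := by
    have := mul_le_mul_of_nonneg_right h (sq_nonneg (boxSide ρ))
    calc boxSide ρ ^ 3 * (8 * Real.pi ^ 2 * nsq (e _ p)) * |galerkinMin v ρ ⟨p, hp⟩|
        = 2 * boxSide ρ ^ 3 * (4 * Real.pi ^ 2 * nsq (e (boxSize ρ) p) / boxSide ρ ^ 2) *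
            |galerkinMin v ρ ⟨p, hp⟩| * boxSide ρ ^ 2 := by field_simp; ring
      _ ≤ W v ρ 0 * boxSide ρ ^ 2 := this
  calc ρ * boxSide ρ ^ 3 * |galerkinMin v ρ ⟨p, hp⟩| * (8 * Real.pi ^ 2 * nsq (e (boxSize ρ) p))
      = ρ * (boxSide ρ ^ 3 * (8 * Real.pi ^ 2 * nsq (e _ p)) * |galerkinMin v ρ ⟨p, hp⟩|) := by ring
    _ ≤ ρ * (W v ρ 0 * boxSide ρ ^ 2) := mul_le_mul_of_nonneg_left h' hρ.le
    _ = ρ * W v ρ 0 * boxSide ρ ^ 2 := by ring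

end BCSTrial

end Literature.MathematicalPhysics.QuantumManyBody.BoseGas

end
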